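/-
Copyright (c) 2026. All rights reserved.
Released under Apache 2.0 license as described in the file LICENSE.
-/
import Literature.Probability.LatticeModels.PinBounds
import Literature.Probability.LatticeModels.CoexistenceGoodAbove
import Literature.Probability.LatticeModels.GoodBelowFromReflection
import Literature.Probability.LatticeModels.AizenmanHiguchiPerMeasure
import Literature.Probability.LatticeModels.AizenmanHiguchiFromCrossings
import Literature.Probability.LatticeModels.SingleSignAnchoring
import Literature.Probability.LatticeModels.SingleSignGoodAbove
import Literature.Probability.LatticeModels.OrthogonalButterflies
import HarnessLib

/-!
# Aizenman–Higuchi from good paths above the square (GH2000, Lemma 5.5 ⇒ Prop. 5.1 ⇒ Theorem)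

Georgii–Higuchi, J. Math. Phys. 41 (2000), proof of Lemma 5.5 (p. 16): "To conclude the proof of
the lemma, we let `A_{x,y}` denote the event that there exists a `≤∗`path from `x` to `y` above
`Δ`, and `B_{x,y}` the event that such a path exists below `Δ`. … The last inequality follows from
the claim and its analogue for the lower half-plane. However, if `A_{x,y} ∩ B_{x,y}` occurs then `Δ`
is surrounded by a `≤∗`circuit for the duplicated system. Letting `Δ ↑ ℤ²` … Since this event is
measurable with respect to the product-tail `𝒯⁽²⁾` on which `ν̂` is trivial, the lemma follows."
and then Proposition 5.1 and the Theorem (p. 16).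

This file reduces the Aizenman–Higuchi theorem (`aizenman_higuchi`, `GibbsStates.lean`) to the
"claim" in the form used by this formalisation — a lower bound for the probability of
`GoodAboveW m H x y` (`NoBadPercolationW`), uniform in `m`, for *every* tail-trivial Gibbs measure
and every horizontal unit translate:

* `goodBelowW_of_goodAboveW_reflect`, `le_measureReal_goodBelowW_of_reflect` — the analogue for the
  lower half-plane is the claim for the measure reflected in the axis (`μ ∘ R₁⁻¹`, again a
  tail-trivial Gibbs measure; `LowerType` is the reflection of `UpperType`,
  `Percolation.lowerType_map_reflect`);
* `ae_no_badPercolation_of_plus_null`, `ae_no_badPercolation_of_minus_null` — if one sign does not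
  percolate in the plane (for a tail-trivial measure: the plus or minus state), there is trivially
  no bad percolation (a bad cluster is a `+`cluster of the first layer and a `-`cluster of the
  second);
* `ae_no_badPercolation_of_goodAbove_bounds` — the claim for `μ` and for `μ ∘ R₁⁻¹` gives almost
  surely no infinite bad cluster in the horizontally duplicated system (`ae_no_bad_percolation_of_goodW`);
* **`aizenman_higuchi_of_seaCases`** — combined with `le_measureReal_goodAboveW_caseA` (Case 3 of
  GH's proof) and the zero–one laws: the theorem follows from the claim in the two remaining cases
  of GH's case distinction ("`μ(E⁺_up) = 0`", "`μ(E⁻_up) = 0`") for tail-trivial measures under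
  which both signs percolate in `ℤ²` — the input here (`aizenman_higuchi_of_ae_no_badPercolation`,
  vertical direction by transposition);
* `map_flipSwap_prod`, `measureReal_goodAboveW_eq_flipSwap`,
  **`aizenman_higuchi_of_plusSeaCase`** — Case 2 reduces to Case 1 by the flip–swap
  `(ω, ω̂) ↦ (-ω̂, -ω)` of the duplicated system;
* `goodAbove_bound_singleSign` — the remaining single-sign case ("`μ(E⁺_up) = 1`, `μ(E⁻_up) = 0`")
  from the tree's `SingleSignAnchoring` / `SingleSignGoodAbove` with the pin bounds of `PinBounds`;
* **`aizenman_higuchi_holds`** — the complete proof of `aizenman_higuchi` (the orthogonal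
  butterflies lemma `exists_horizontal_butterfly_of_coexistence` rules out the case of neither sign
  percolating in the half-plane).

## References

* H.-O. Georgii, Y. Higuchi, J. Math. Phys. 41 (2000) 1153–1169, Lemma 5.5 and its proof,
  Prop. 5.1, Theorem [GeorgiiHiguchi2000].
-/

namespace Literature.Probability.LatticeModels

open MeasureTheory SimpleGraph Percolation Filter
open scoped ENNReal

noncomputable section

variable {β : ℝ} {μ : Measure (SpinConfig (Site 2))}

/-! ### The lower half-plane by reflection -/

section Reflect

/-- **The lower bound for good paths below the square from the bound above the square for the
reflected measure.** [cite: GeorgiiHiguchi2000, Lemma 5.5 (proof, p. 16)] -/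
theorem le_measureReal_goodBelowW_shift_of_reflect (μ : Measure (SpinConfig (Site 2))) [IsFiniteMeasure μ] (v : Site 2)
    {m H : ℕ} (hm : 1 ≤ m) {x y : Site 2} (hx : x 1 = 0) (hy : y 1 = 0) :
    ((μ.map (configRelabel (reflectCoord (d := 2) 1).toEquiv)).prod
        ((μ.map (configRelabel (reflectCoord (d := 2) 1).toEquiv)).map (configShift (reflectCoord 1 v)))).real
        {p | GoodAboveW m H x y p} ≤
      (μ.prod (μ.map (configShift v))).real {p | GoodBelowW m H x y p} := by
  have hρ : Measurable (configRelabel (reflectCoord (d := 2) 1).toEquiv : SpinConfig (Site 2) → SpinConfig (Site 2)) :=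
    (configRelabel _).measurable
  haveI : IsFiniteMeasure (μ.map (configShift (S := ℤˣ) v)) := Measure.isFiniteMeasure_map _ _
  have heq : (μ.map (configRelabel (reflectCoord (d := 2) 1).toEquiv)).prod
      ((μ.map (configRelabel (reflectCoord (d := 2) 1).toEquiv)).map (configShift (reflectCoord 1 v))) =
      (μ.prod (μ.map (configShift v))).map (Prod.map (configRelabel (reflectCoord (d := 2) 1).toEquiv)
        (configRelabel (reflectCoord (d := 2) 1).toEquiv)) := by
    rw [Measure.map_map (configShift (reflectCoord 1 v)).measurable hρ, ← configRelabel_reflectCoord_one_comp_configShift,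
      ← Measure.map_map hρ (configShift v).measurable, Measure.map_prod_map _ _ hρ hρ]
  rw [heq, measureReal_def, Measure.map_apply (hρ.prodMap hρ) (measurableSet_goodAboveW m H x y), measureReal_def]
  exact ENNReal.toReal_mono (measure_ne_top _ _) (measure_mono fun p hp => goodBelowW_of_goodAboveW_reflect hm hx hy hp)

end Reflect

/-! ### The trivial cases: one sign does not percolate in the plane -/

section Trivial

/-- `E^s = E^s_{ℤ²}` as an `existsInfClusterIn` event. [folklore] -/
theorem existsInfCluster_eq_existsInfClusterIn_univ (s : ℤˣ) :
    (existsInfCluster (zdGraph 2) s : Set (SpinConfig (Site 2))) = existsInfClusterIn (zdGraph 2) s Set.univ := by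
  ext ω
  simp only [existsInfCluster, existsInfClusterIn, Set.mem_setOf_eq, Set.inter_univ, sitePercolatesAt]

/-- Bad sites are `+`sites of the first layer and `-`sites of the second. [folklore] -/
theorem spinSites_badConfig_subset (p : SpinConfig (Site 2) × SpinConfig (Site 2)) :
    spinSites 1 (badConfig p) ⊆ spinSites 1 p.1 ∩ spinSites (-1) p.2 := fun z hz => by
  rw [mem_spinSites_badConfig] at hz
  exact ⟨hz.1, hz.2⟩

/-- **No bad percolation when the first layer has no infinite `+`cluster**: a bad cluster is
contained in a `+`cluster of the first layer. [cite: GeorgiiHiguchi2000, Lemma 5.5 (proof, Cases 1–2, degenerate form)] -/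
theorem ae_no_badPercolation_of_plus_null {μ' : Measure (SpinConfig (Site 2))} [SFinite μ']
    (h : μ (existsInfCluster (zdGraph 2) 1) = 0) :
    ∀ᵐ p ∂(μ.prod μ'), ∀ t, ¬ (siteCluster (zdGraph 2) (spinSites 1 (badConfig p)) t).Infinite := by
  have h1 : ∀ᵐ ω ∂μ, ω ∉ existsInfCluster (zdGraph 2) 1 := measure_eq_zero_iff_ae_notMem.1 h
  filter_upwards [(Measure.quasiMeasurePreserving_fst (μ := μ) (ν := μ')).ae h1] with p hp t ht
  exact hp ⟨t, ht.mono (siteCluster_mono (fun z hz => (spinSites_badConfig_subset p hz).1) t)⟩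

/-- `E^s` is invariant under translations. [folklore] -/
theorem configShift_mem_existsInfCluster_iff (v : Site 2) (s : ℤˣ) (ω : SpinConfig (Site 2)) :
    configShift v ω ∈ existsInfCluster (zdGraph 2) s ↔ ω ∈ existsInfCluster (zdGraph 2) s := by
  rw [existsInfCluster_eq_existsInfClusterIn_univ, configShift_eq_configRelabel,
    show Site.shift v = (zdShiftIso (d := 2) v).toEquiv from rfl, configRelabel_mem_existsInfClusterIn_iff, Set.preimage_univ]

/-- **No bad percolation when the second layer has no infinite `-`cluster** (the second layer is a
translate of the first). [cite: GeorgiiHiguchi2000, Lemma 5.5 (proof, Cases 1–2, degenerate form)] -/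
theorem ae_no_badPercolation_of_minus_null [SFinite μ] (h : μ (existsInfCluster (zdGraph 2) (-1)) = 0) (v : Site 2) :
    ∀ᵐ p ∂(μ.prod (μ.map (configShift v))), ∀ t, ¬ (siteCluster (zdGraph 2) (spinSites 1 (badConfig p)) t).Infinite := by
  classical
  have h1 : ∀ᵐ ω ∂μ, ω ∉ existsInfCluster (zdGraph 2) (-1) := measure_eq_zero_iff_ae_notMem.1 h
  have h2 : ∀ᵐ ω ∂(μ.map (configShift v)), ω ∉ existsInfCluster (zdGraph 2) (-1) := by
    rw [ae_map_iff (configShift v).measurable.aemeasurable (measurableSet_existsInfCluster (G := zdGraph 2) (-1)).compl]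
    filter_upwards [h1] with ω hω hω'
    exact hω ((configShift_mem_existsInfCluster_iff v (-1) ω).1 hω')
  filter_upwards [(Measure.quasiMeasurePreserving_snd (μ := μ) (ν := μ.map (configShift v))).ae h2] with p hp t ht
  exact hp ⟨t, ht.mono (siteCluster_mono (fun z hz => (spinSites_badConfig_subset p hz).2) t)⟩

end Trivial


/-! ### The flip–swap symmetry of the duplicated system: Case 2 from Case 1 -/

section FlipSwap

/-- The flip–swap `(ω, ω̂) ↦ (-ω̂, -ω)` of the duplicated system is measurable. [cite: GeorgiiHiguchi2000, Lemma 5.5 (proof, Case 2: "Interchanging `+` and `-` and replacing `μ` by `μ̂`")] -/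
theorem measurable_flipSwap :
    Measurable fun p : SpinConfig (Site 2) × SpinConfig (Site 2) => ((-p.2, -p.1) : SpinConfig (Site 2) × SpinConfig (Site 2)) :=
  (measurable_neg.comp measurable_snd).prodMk (measurable_neg.comp measurable_fst)

/-- Good sites are invariant under the flip–swap. [folklore] -/
theorem not_mem_spinSites_badConfig_flipSwap_iff {p : SpinConfig (Site 2) × SpinConfig (Site 2)} {z : Site 2} :
    z ∉ spinSites 1 (badConfig ((-p.2, -p.1) : SpinConfig (Site 2) × SpinConfig (Site 2))) ↔ z ∉ spinSites 1 (badConfig p) := by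
  rw [mem_spinSites_badConfig, mem_spinSites_badConfig]
  simp only [Pi.neg_apply, neg_eq_iff_eq_neg, neg_neg]
  tauto

/-- `GoodAboveW` is invariant under the flip–swap. [cite: GeorgiiHiguchi2000, Lemma 5.5 (proof, Case 2)] -/
theorem goodAboveW_flipSwap_iff {m H : ℕ} {x y : Site 2} {p : SpinConfig (Site 2) × SpinConfig (Site 2)} :
    GoodAboveW m H x y ((-p.2, -p.1) : SpinConfig (Site 2) × SpinConfig (Site 2)) ↔ GoodAboveW m H x y p := by
  constructor
  · rintro ⟨α, hU, hα⟩; exact ⟨α, hU, fun z hz => ⟨not_mem_spinSites_badConfig_flipSwap_iff.1 (hα z hz).1, (hα z hz).2⟩⟩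
  · rintro ⟨α, hU, hα⟩; exact ⟨α, hU, fun z hz => ⟨not_mem_spinSites_badConfig_flipSwap_iff.2 (hα z hz).1, (hα z hz).2⟩⟩

/-- The flip commutes with translations. [folklore] -/
theorem neg_comp_configShift (v : Site 2) :
    (fun σ : SpinConfig (Site 2) => -σ) ∘ configShift v = configShift v ∘ fun σ : SpinConfig (Site 2) => -σ := by
  funext σ; funext x; simp [configShift_apply]

/-- **The duplicated system under the flip–swap**: for `μ₁ = (μ ∘ (-)⁻¹) ∘ θ_v⁻¹`,
`flipSwap_* (μ ⊗ μ ∘ θ_v⁻¹) = μ₁ ⊗ μ₁ ∘ θ_{-v}⁻¹`. [cite: GeorgiiHiguchi2000, Lemma 5.5 (proof, Case 2)] -/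
theorem map_flipSwap_prod (μ : Measure (SpinConfig (Site 2))) [SFinite μ] (v : Site 2) :
    (μ.prod (μ.map (configShift v))).map (fun p : SpinConfig (Site 2) × SpinConfig (Site 2) => ((-p.2, -p.1) : SpinConfig (Site 2) × SpinConfig (Site 2))) =
      ((μ.map fun σ : SpinConfig (Site 2) => -σ).map (configShift v)).prod
        (((μ.map fun σ : SpinConfig (Site 2) => -σ).map (configShift v)).map (configShift (-v))) := by
  have hn : Measurable fun σ : SpinConfig (Site 2) => -σ := measurable_neg
  have hv : Measurable (configShift (S := ℤˣ) v : SpinConfig (Site 2) → SpinConfig (Site 2)) := (configShift v).measurable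
  have hv' : Measurable (configShift (S := ℤˣ) (-v) : SpinConfig (Site 2) → SpinConfig (Site 2)) := (configShift (-v)).measurable
  have hfs : (fun p : SpinConfig (Site 2) × SpinConfig (Site 2) => ((-p.2, -p.1) : SpinConfig (Site 2) × SpinConfig (Site 2))) =
      Prod.swap ∘ Prod.map (fun σ : SpinConfig (Site 2) => -σ) (fun σ : SpinConfig (Site 2) => -σ) := by
    funext p; rfl
  rw [hfs, ← Measure.map_map measurable_swap (hn.prodMap hn), ← Measure.map_prod_map _ _ hn hn, Measure.prod_swap,
    Measure.map_map hn hv, neg_comp_configShift, ← Measure.map_map hv hn,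
    Measure.map_map hv' hv, configShift_neg_comp, Measure.map_id]

/-- **Case 2 from Case 1**: the `GoodAboveW` probabilities of `μ ⊗ μ ∘ θ_v⁻¹` are those of
`μ₁ ⊗ μ₁ ∘ θ_{-v}⁻¹`, `μ₁ = (μ ∘ (-)⁻¹) ∘ θ_v⁻¹`. [cite: GeorgiiHiguchi2000, Lemma 5.5 (proof, Case 2)] -/
theorem measureReal_goodAboveW_eq_flipSwap (μ : Measure (SpinConfig (Site 2))) [SFinite μ] (v : Site 2)
    (m H : ℕ) (x y : Site 2) :
    (μ.prod (μ.map (configShift v))).real {p | GoodAboveW m H x y p} =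
      (((μ.map fun σ : SpinConfig (Site 2) => -σ).map (configShift v)).prod
        (((μ.map fun σ : SpinConfig (Site 2) => -σ).map (configShift v)).map (configShift (-v)))).real
          {p | GoodAboveW m H x y p} := by
  rw [← map_flipSwap_prod, measureReal_def, measureReal_def, Measure.map_apply measurable_flipSwap (measurableSet_goodAboveW m H x y)]
  congr 1
  exact congrArg _ (Set.ext fun p => goodAboveW_flipSwap_iff.symm)

/-- Half-plane `-`percolation of `ω` is half-plane `+`percolation of `θ_v(-ω)` for a horizontal
`v`. [folklore] -/
theorem exists_infinite_plusCluster_configShift_neg_iff (s : ℤ) (ω : SpinConfig (Site 2)) :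
    (∃ x, (siteCluster (zdGraph 2) (spinSites 1 (configShift (Pi.single 0 s) (-ω)) ∩ halfPlane 0) x).Infinite) ↔
      ∃ y, (siteCluster (zdGraph 2) (spinSites (-1) ω ∩ halfPlane 0) y).Infinite := by
  rw [← exists_infinite_minusCluster_configShift_iff s ω]
  have : configShift (Pi.single 0 s) (-ω) = -configShift (Pi.single 0 s) ω := by
    funext x; simp [configShift_apply]
  simp only [this, spinSites_neg_config]

end FlipSwap


/-! ### The single-sign case (GH Case 1: `μ(E⁺_up) = 1`, `μ(E⁻_up) = 0`) -/

section SingleSign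

/-- Horizontal shifts preserve the upper half-plane. [folklore] -/
theorem zdShiftIso_preimage_halfPlane_zero (s : ℤ) :
    (zdShiftIso (d := 2) (Pi.single 0 s)) ⁻¹' (halfPlane (0 : ℤ)) = halfPlane 0 := by
  ext x
  simp [halfPlane, zdShiftIso_apply]

/-- `E^t_up` has the same probability under `μ ∘ θ_{s e₁}⁻¹` as under `μ`. [folklore] -/
theorem measure_map_configShift_existsInfClusterIn_halfPlane (μ : Measure (SpinConfig (Site 2))) (s : ℤ) (t : ℤˣ) :
    (μ.map (configShift (Pi.single 0 s))) (existsInfClusterIn (zdGraph 2) t (halfPlane (0 : ℤ))) =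
      μ (existsInfClusterIn (zdGraph 2) t (halfPlane (0 : ℤ))) := by
  classical
  rw [Measure.map_apply (configShift _).measurable (MeasurableSet.of_tailEvents
    (measurableSet_tailEvents_existsInfClusterIn (G := zdGraph 2) t (halfPlane 0)))]
  congr 1
  ext ω
  rw [Set.mem_preimage, configShift_eq_configRelabel, show Site.shift (Pi.single 0 s) = (zdShiftIso (d := 2) (Pi.single 0 s)).toEquiv from rfl,
    configRelabel_mem_existsInfClusterIn_iff, zdShiftIso_preimage_halfPlane_zero]

/-- **Good paths above the square in the single-sign case** (Georgii–Higuchi 2000, Lemma 5.5,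
proof, Case 1, in the form "`μ(E⁺_up) = 1`, `μ(E⁻_up) = 0`"): for `β > β_c(2)`, a tail-trivial
`μ ∈ 𝒢(β, 0)` whose upper half-plane almost surely contains an infinite `+`cluster and no infinite
`-`cluster, and `s = ±1`, there is `c > 0` such that for every `m ≥ 1`, all axis sites `x` far to
the left, `y` far to the right and all large `H`, `c ≤ (μ ⊗ μ ∘ θ_{s e₁}⁻¹)(GoodAboveW m H x y)`:
both pins in the second layer (`SingleSignAnchoring`, `PinBounds`, `SingleSignGoodAbove`). [cite: GeorgiiHiguchi2000, Lemma 5.5 (proof, Case 1, p. 15)] -/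
theorem goodAbove_bound_singleSign (hβc : criticalBeta 2 < β) (hμ : μ ∈ isingGibbsMeasures 2 β 0) (hμt : IsTailTrivial μ)
    (hP : ∀ᵐ ω ∂μ, ∃ x, (siteCluster (zdGraph 2) (spinSites 1 ω ∩ halfPlane 0) x).Infinite)
    (hNoM : μ (existsInfClusterIn (zdGraph 2) (-1) (halfPlane (0 : ℤ))) = 0) (s : ℤˣ) :
    ∃ c : ℝ, 0 < c ∧ ∀ m : ℕ, 1 ≤ m → ∃ a₀ b₀ : ℕ, ∀ a b : ℕ, a₀ ≤ a → b₀ ≤ b → ∃ H₀ : ℕ, ∀ H : ℕ, H₀ ≤ H →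
      c ≤ (μ.prod (μ.map (configShift (Pi.single 0 (s : ℤ))))).real {p | GoodAboveW m H (![-(a : ℤ), 0]) (![(b : ℤ), 0]) p} := by
  classical
  have hβ : 0 ≤ β := (criticalBeta_nonneg 2).trans hβc.le
  have hμG : IsGibbsMeasure (isingSpecification (zdGraph 2) β 0) μ := hμ
  haveI := hμG.isProbabilityMeasure
  set μ₂ : Measure (SpinConfig (Site 2)) := μ.map (configShift (Pi.single 0 (s : ℤ))) with hμ₂
  have hμ₂G : μ₂ ∈ isingGibbsMeasures 2 β 0 := mem_isingGibbsMeasures_map_configShift hμ _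
  have hμ₂GG : IsGibbsMeasure (isingSpecification (zdGraph 2) β 0) μ₂ := hμ₂G
  haveI : IsProbabilityMeasure μ₂ := hμ₂GG.isProbabilityMeasure
  have hμ₂t : IsTailTrivial μ₂ := by rw [hμ₂, configShift_eq_configRelabel]; exact hμt.map_configRelabel _
  have hP2 : ∀ᵐ ω ∂μ₂, ∃ x, (siteCluster (zdGraph 2) (spinSites 1 ω ∩ halfPlane 0) x).Infinite := by
    have h := (ae_exists_infinite_cluster_map_configShift_iff_lattice (μ := μ) 1 (Pi.single 0 (s : ℤ)) 0).2
    simp only [Pi.single_eq_of_ne (show (1 : Fin 2) ≠ 0 by decide), sub_zero] at h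
    exact h hP
  have hNoM2 : μ₂ (existsInfClusterIn (zdGraph 2) (-1) (halfPlane (0 : ℤ))) = 0 := by
    rw [hμ₂, measure_map_configShift_existsInfClusterIn_halfPlane]; exact hNoM
  obtain ⟨hθpos, -⟩ := exists_state_plusPercProb_le hβc
  have hθ : 0 ≤ plusPercProb β / 8 := by linarith
  refine ⟨plusPercProb β / 8 * (plusPercProb β / 8) / 2, by positivity, fun m hm => ?_⟩
  -- the two pin bounds in the second layer
  obtain ⟨Nx, hNx⟩ := exists_pinLeft_ge_of_ae_anchored hβc hμ₂G m (ae_leftAnchoredInf_of_singleSign hμ₂G hμ₂t hP2 hNoM2 m)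
  set μ₄ : Measure (SpinConfig (Site 2)) := μ₂.map refl0 with hμ₄
  have hμ₄G : μ₄ ∈ isingGibbsMeasures 2 β 0 := IsGibbsMeasure.map_configRelabel _ (reflectCoord 0) hμ₂GG
  have hanch₄ : ∀ᵐ ω ∂μ₄, LeftAnchoredInf m ω := by
    rw [hμ₄, ae_map_iff measurable_refl0.aemeasurable measurableSet_leftAnchoredInf]
    exact ae_leftAnchoredInf_refl0_of_singleSign hμ₂G hμ₂t hP2 hNoM2 m
  obtain ⟨Ny, hNy⟩ := exists_pinLeft_ge_of_ae_anchored hβc hμ₄G m hanch₄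
  refine ⟨Nx, Ny, fun a b ha hb => ?_⟩
  set x : Site 2 := ![-(a : ℤ), 0] with hx
  set y : Site 2 := ![(b : ℤ), 0] with hy
  have hx1 : x 1 = 0 := by simp [hx]
  have hy1 : y 1 = 0 := by simp [hy]
  have hpx := hNx x hx1 (by simp [hx]; omega)
  have hpy : plusPercProb β / 8 ≤ μ₂.real {ω | PinRightPlus m y ω} := by
    have hc := reflectCoord_zero_apply y
    have h := hNy (reflectCoord 0 y) (by rw [hc.2, hy1]) (by rw [hc.1]; simp [hy]; omega)
    rwa [hμ₄, measureReal_def, Measure.map_apply measurable_refl0 (measurableSet_pinLeft (m := m) _), ← measureReal_def] at h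
  obtain ⟨H₀, hH₀⟩ := le_measureReal_goodAboveW_of_pins_plus hβ hμ hμ₂G hμ₂t hm
    (ae_starCluster_unique_halfPlane_diff_box hβc hμ₂G m) x y hy1 hθ hpx hpy
    (show (0 : ℝ) < plusPercProb β / 8 * (plusPercProb β / 8) / 2 by positivity)
  exact ⟨H₀, fun H hH => by have := hH₀ H hH; linarith⟩

/-- `E^t_up` under the flip–shift `μ₁ = (μ ∘ (-)⁻¹) ∘ θ_{s e₁}⁻¹` is `E^{-t}_up` under `μ`. [folklore] -/
theorem measure_flipShift_existsInfClusterIn_halfPlane (μ : Measure (SpinConfig (Site 2))) (s : ℤ) (t : ℤˣ) :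
    ((μ.map fun σ : SpinConfig (Site 2) => -σ).map (configShift (Pi.single 0 s))) (existsInfClusterIn (zdGraph 2) t (halfPlane (0 : ℤ))) =
      μ (existsInfClusterIn (zdGraph 2) (-t) (halfPlane (0 : ℤ))) := by
  classical
  rw [measure_map_configShift_existsInfClusterIn_halfPlane,
    Measure.map_apply measurable_neg (MeasurableSet.of_tailEvents (measurableSet_tailEvents_existsInfClusterIn (G := zdGraph 2) t (halfPlane 0)))]
  congr 1
  ext ω
  simp only [Set.mem_preimage, mem_existsInfClusterIn_iff, spinSites_neg_config]

end SingleSign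

/-! ### From the bounds to the theorem -/

section Main

/-- **No bad percolation from good paths above the square for `μ` and for its reflection** (GH
Lemma 5.5 with its proof, per measure): if for some `c₁, c₂ > 0` and every `m ≥ 1`, for all axis
sites `x` far to the left, `y` far to the right and all large `H`,
`c₁ ≤ (μ ⊗ μ ∘ θ_{s e₁}⁻¹)(GoodAboveW m H x y)` and the same with `c₂` for the reflected measure
`μ ∘ R₁⁻¹`, then `μ ⊗ μ ∘ θ_{s e₁}⁻¹`-almost surely no bad cluster is infinite. [cite: GeorgiiHiguchi2000, Lemma 5.5] -/
theorem ae_no_badPercolation_of_goodAbove_bounds (hβc : criticalBeta 2 < β) (hμ : μ ∈ isingGibbsMeasures 2 β 0)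
    (hμt : IsTailTrivial μ) (s : ℤˣ) {c₁ c₂ : ℝ} (hc₁ : 0 < c₁) (hc₂ : 0 < c₂)
    (h₁ : ∀ m : ℕ, 1 ≤ m → ∃ a₀ b₀ : ℕ, ∀ a b : ℕ, a₀ ≤ a → b₀ ≤ b → ∃ H₀ : ℕ, ∀ H : ℕ, H₀ ≤ H →
        c₁ ≤ (μ.prod (μ.map (configShift (Pi.single 0 (s : ℤ))))).real {p | GoodAboveW m H (![-(a : ℤ), 0]) (![(b : ℤ), 0]) p})
    (h₂ : ∀ m : ℕ, 1 ≤ m → ∃ a₀ b₀ : ℕ, ∀ a b : ℕ, a₀ ≤ a → b₀ ≤ b → ∃ H₀ : ℕ, ∀ H : ℕ, H₀ ≤ H →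
        c₂ ≤ ((μ.map (configRelabel (reflectCoord (d := 2) 1).toEquiv)).prod
          ((μ.map (configRelabel (reflectCoord (d := 2) 1).toEquiv)).map (configShift (Pi.single 0 (s : ℤ))))).real
            {p | GoodAboveW m H (![-(a : ℤ), 0]) (![(b : ℤ), 0]) p}) :
    ∀ᵐ p ∂(μ.prod (μ.map (configShift (Pi.single 0 (s : ℤ))))),
      ∀ t, ¬ (siteCluster (zdGraph 2) (spinSites 1 (badConfig p)) t).Infinite := by
  have hβ : 0 ≤ β := (criticalBeta_nonneg 2).trans hβc.le
  have hμG : IsGibbsMeasure (isingSpecification (zdGraph 2) β 0) μ := hμ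
  haveI := hμG.isProbabilityMeasure
  have hμ' : μ.map (configShift (Pi.single 0 (s : ℤ))) ∈ isingGibbsMeasures 2 β 0 := mem_isingGibbsMeasures_map_configShift hμ _
  have hμ't : IsTailTrivial (μ.map (configShift (Pi.single 0 (s : ℤ)))) := by
    rw [configShift_eq_configRelabel]; exact hμt.map_configRelabel _
  refine ae_no_bad_percolation_of_goodW hβ hμ hμ' hμt hμ't hc₁ hc₂ fun m hm => ?_
  obtain ⟨a₁, b₁, hN₁⟩ := h₁ m hm
  obtain ⟨a₂, b₂, hN₂⟩ := h₂ m hm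
  set a := max a₁ a₂ with ha
  set b := max b₁ b₂ with hb
  set x : Site 2 := ![-(a : ℤ), 0] with hx
  set y : Site 2 := ![(b : ℤ), 0] with hy
  have hx1 : x 1 = 0 := by simp [hx]
  have hy1 : y 1 = 0 := by simp [hy]
  obtain ⟨H₁, hH₁⟩ := hN₁ a b (le_max_left _ _) (le_max_left _ _)
  obtain ⟨H₂, hH₂⟩ := hN₂ a b (le_max_right _ _) (le_max_right _ _)
  refine ⟨max H₁ H₂, x, y, hH₁ _ (le_max_left _ _), ?_⟩
  have h := hH₂ _ (le_max_right H₁ H₂)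
  rw [← reflectCoord_one_single_zero (s : ℤ)] at h
  exact h.trans (le_measureReal_goodBelowW_shift_of_reflect μ (Pi.single 0 (s : ℤ)) hm hx1 hy1)

/-- **The Aizenman–Higuchi theorem from the "sea" cases under coexistence in the plane**
(Georgii–Higuchi 2000, proof of Lemma 5.5, Cases 1 and 2, in the only situation not covered by
this formalisation): the theorem holds provided that for every tail-trivial `μ ∈ 𝒢(β, 0)` under
which *both* signs percolate in `ℤ²` but the upper half-plane contains no infinite `+`cluster
(Case 1, "`μ(E⁺_up) = 0`") or no infinite `-`cluster (Case 2, "`μ(E⁻_up) = 0`"), good paths above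
the square have probability bounded below, uniformly in `m`, for all far axis sites. The other
situations are settled here: if one sign does not percolate in `ℤ²` there is trivially no bad
percolation (`ae_no_badPercolation_of_plus_null`, `…_minus_null`); Case 3 is
`le_measureReal_goodAboveW_caseA`; the lower half-plane is the upper half-plane of `μ ∘ R₁⁻¹`;
the cases exhaust by the zero–one laws; the vertical direction by transposition. [cite: GeorgiiHiguchi2000, Lemma 5.5 (proof, Cases 1–3), Prop. 5.1 and Theorem] -/
theorem aizenman_higuchi_of_seaCases
    (hSea : criticalBeta 2 < β → ∀ μ ∈ isingGibbsMeasures 2 β 0, IsTailTrivial μ →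
      μ (existsInfCluster (zdGraph 2) 1) = 1 → μ (existsInfCluster (zdGraph 2) (-1)) = 1 →
      (μ {ω | ∃ x, (siteCluster (zdGraph 2) (spinSites 1 ω ∩ halfPlane 0) x).Infinite} = 0 ∨
        μ {ω | ∃ y, (siteCluster (zdGraph 2) (spinSites (-1) ω ∩ halfPlane 0) y).Infinite} = 0) →
      ∀ s : ℤˣ, ∃ c : ℝ, 0 < c ∧ ∀ m : ℕ, 1 ≤ m → ∃ a₀ b₀ : ℕ, ∀ a b : ℕ, a₀ ≤ a → b₀ ≤ b → ∃ H₀ : ℕ, ∀ H : ℕ, H₀ ≤ H →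
          c ≤ (μ.prod (μ.map (configShift (Pi.single 0 (s : ℤ))))).real {p | GoodAboveW m H (![-(a : ℤ), 0]) (![(b : ℤ), 0]) p}) :
    aizenman_higuchi (β := β) := by
  classical
  -- the bound for every tail-trivial `μ` with both signs percolating in the plane
  have hGA : criticalBeta 2 < β → ∀ μ ∈ isingGibbsMeasures 2 β 0, IsTailTrivial μ →
      μ (existsInfCluster (zdGraph 2) 1) = 1 → μ (existsInfCluster (zdGraph 2) (-1)) = 1 → ∀ s : ℤˣ, ∃ c : ℝ, 0 < c ∧
      ∀ m : ℕ, 1 ≤ m → ∃ a₀ b₀ : ℕ, ∀ a b : ℕ, a₀ ≤ a → b₀ ≤ b → ∃ H₀ : ℕ, ∀ H : ℕ, H₀ ≤ H →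
        c ≤ (μ.prod (μ.map (configShift (Pi.single 0 (s : ℤ))))).real {p | GoodAboveW m H (![-(a : ℤ), 0]) (![(b : ℤ), 0]) p} := by
    intro hβc μ hμ hμt hp hm s
    have hμG : IsGibbsMeasure (isingSpecification (zdGraph 2) β 0) μ := hμ
    haveI := hμG.isProbabilityMeasure
    have hmeas : ∀ t : ℤˣ, MeasurableSet (existsInfClusterIn (zdGraph 2) t (halfPlane (0 : ℤ)) : Set (SpinConfig (Site 2))) :=
      fun t => MeasurableSet.of_tailEvents (measurableSet_tailEvents_existsInfClusterIn (G := zdGraph 2) t (halfPlane 0))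
    rcases hμt.measure_existsInfClusterIn (G := zdGraph 2) 1 (halfPlane 0) with hp0 | hp1
    · exact hSea hβc μ hμ hμt hp hm (Or.inl hp0) s
    rcases hμt.measure_existsInfClusterIn (G := zdGraph 2) (-1) (halfPlane 0) with hm0 | hm1
    · exact hSea hβc μ hμ hμt hp hm (Or.inr hm0) s
    have hplus : ∀ᵐ ω ∂μ, ∃ x, (siteCluster (zdGraph 2) (spinSites 1 ω ∩ halfPlane 0) x).Infinite := by
      have : ∀ᵐ ω ∂μ, ω ∈ existsInfClusterIn (zdGraph 2) 1 (halfPlane (0 : ℤ)) := by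
        rw [← prob_compl_eq_zero_iff (hmeas 1)] at hp1; exact ae_iff.2 hp1
      exact this
    have hminus : ∀ᵐ ω ∂μ, ∃ y, (siteCluster (zdGraph 2) (spinSites (-1) ω ∩ halfPlane 0) y).Infinite := by
      have : ∀ᵐ ω ∂μ, ω ∈ existsInfClusterIn (zdGraph 2) (-1) (halfPlane (0 : ℤ)) := by
        rw [← prob_compl_eq_zero_iff (hmeas (-1))] at hm1; exact ae_iff.2 hm1
      exact this
    exact exists_goodAboveW_bound_of_coexistence hβc hμ hμt s hplus hminus
  -- no bad percolation in the horizontally duplicated system of every tail-trivial `μ`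
  have hHor : criticalBeta 2 < β → ∀ μ ∈ isingGibbsMeasures 2 β 0, IsTailTrivial μ → ∀ s : ℤˣ,
      ∀ᵐ p ∂(μ.prod (μ.map (configShift (Pi.single 0 (s : ℤ))))),
        ∀ t, ¬ (siteCluster (zdGraph 2) (spinSites 1 (badConfig p)) t).Infinite := by
    intro hβc μ hμ hμt s
    have hμG : IsGibbsMeasure (isingSpecification (zdGraph 2) β 0) μ := hμ
    haveI := hμG.isProbabilityMeasure
    rcases hμt.measure_existsInfCluster (G := zdGraph 2) 1 with hp0 | hp1
    · exact ae_no_badPercolation_of_plus_null hp0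
    rcases hμt.measure_existsInfCluster (G := zdGraph 2) (-1) with hm0 | hm1
    · exact ae_no_badPercolation_of_minus_null hm0 _
    -- both signs percolate in the plane, for `μ` and for its reflection `μ ∘ R₁⁻¹`
    set ρ : SpinConfig (Site 2) → SpinConfig (Site 2) := ⇑(configRelabel (reflectCoord (d := 2) 1).toEquiv) with hρ
    have hρm : Measurable ρ := (configRelabel _).measurable
    have hμRG : μ.map ρ ∈ isingGibbsMeasures 2 β 0 := IsGibbsMeasure.map_configRelabel _ (reflectCoord 1) hμG
    have hμRt : IsTailTrivial (μ.map ρ) := hμt.map_configRelabel _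
    have hR : ∀ t : ℤˣ, μ (existsInfCluster (zdGraph 2) t) = 1 → (μ.map ρ) (existsInfCluster (zdGraph 2) t) = 1 := by
      intro t ht
      rw [hρ, Measure.map_apply hρm (measurableSet_existsInfCluster (G := zdGraph 2) t)]
      have : ρ ⁻¹' existsInfCluster (zdGraph 2) t = existsInfCluster (zdGraph 2) t := by
        ext ω
        rw [Set.mem_preimage, existsInfCluster_eq_existsInfClusterIn_univ, hρ, configRelabel_mem_existsInfClusterIn_iff,
          Set.preimage_univ]
      rw [this]; exact ht
    obtain ⟨c₁, hc₁, h₁⟩ := hGA hβc μ hμ hμt hp1 hm1 s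
    obtain ⟨c₂, hc₂, h₂⟩ := hGA hβc (μ.map ρ) hμRG hμRt (hR 1 hp1) (hR (-1) hm1) s
    exact ae_no_badPercolation_of_goodAbove_bounds hβc hμ hμt s hc₁ hc₂ h₁ h₂
  refine aizenman_higuchi_of_ae_no_badPercolation fun hβc μ hμ hμt i s => ?_
  have hμG : IsGibbsMeasure (isingSpecification (zdGraph 2) β 0) μ := hμ
  haveI := hμG.isProbabilityMeasure
  fin_cases i
  · exact hHor hβc μ hμ hμt s
  · have hμT : μ.map (configRelabel transposeIso.toEquiv) ∈ isingGibbsMeasures 2 β 0 :=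
      IsGibbsMeasure.map_configRelabel _ transposeIso hμG
    have hμTt : IsTailTrivial (μ.map (configRelabel transposeIso.toEquiv)) := hμt.map_configRelabel _
    exact ae_no_badPercolation_vertical_of_transpose μ (s : ℤ) (hHor hβc _ hμT hμTt s)

/-- **The Aizenman–Higuchi theorem from the single remaining case** ("`μ(E⁺_up) = 0`" under
coexistence in the plane): Case 2 ("`μ(E⁻_up) = 0`") of `aizenman_higuchi_of_seaCases` reduces to
Case 1 for the measure `(μ ∘ (-)⁻¹) ∘ θ_{s e₁}⁻¹` by the flip–swap symmetry of the duplicated system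
(GH: "Interchanging `+` and `-` and replacing `μ` by `μ̂`"). [cite: GeorgiiHiguchi2000, Lemma 5.5 (proof, Cases 1–2)] -/
theorem aizenman_higuchi_of_plusSeaCase
    (hSea : criticalBeta 2 < β → ∀ μ ∈ isingGibbsMeasures 2 β 0, IsTailTrivial μ →
      μ (existsInfCluster (zdGraph 2) 1) = 1 → μ (existsInfCluster (zdGraph 2) (-1)) = 1 →
      μ {ω | ∃ x, (siteCluster (zdGraph 2) (spinSites 1 ω ∩ halfPlane 0) x).Infinite} = 0 →
      ∀ s : ℤˣ, ∃ c : ℝ, 0 < c ∧ ∀ m : ℕ, 1 ≤ m → ∃ a₀ b₀ : ℕ, ∀ a b : ℕ, a₀ ≤ a → b₀ ≤ b → ∃ H₀ : ℕ, ∀ H : ℕ, H₀ ≤ H →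
          c ≤ (μ.prod (μ.map (configShift (Pi.single 0 (s : ℤ))))).real {p | GoodAboveW m H (![-(a : ℤ), 0]) (![(b : ℤ), 0]) p}) :
    aizenman_higuchi (β := β) := by
  classical
  refine aizenman_higuchi_of_seaCases fun hβc μ hμ hμt hp hm hcase s => ?_
  rcases hcase with h0 | h0
  · exact hSea hβc μ hμ hμt hp hm h0 s
  · -- Case 2: pass to `μ₁ = (μ ∘ (-)⁻¹) ∘ θ_{s e₁}⁻¹` and `-s`
    have hμG : IsGibbsMeasure (isingSpecification (zdGraph 2) β 0) μ := hμ
    haveI := hμG.isProbabilityMeasure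
    set μn : Measure (SpinConfig (Site 2)) := μ.map fun σ : SpinConfig (Site 2) => -σ with hμn
    set μ₁ : Measure (SpinConfig (Site 2)) := μn.map (configShift (Pi.single 0 (s : ℤ))) with hμ₁
    have hμnG : μn ∈ isingGibbsMeasures 2 β 0 := isGibbsMeasure_map_neg (zdGraph 2) β hμG
    have hμnt : IsTailTrivial μn := hμt.map_neg
    have hμ₁G : μ₁ ∈ isingGibbsMeasures 2 β 0 := mem_isingGibbsMeasures_map_configShift hμnG _
    have hμ₁t : IsTailTrivial μ₁ := by rw [hμ₁, configShift_eq_configRelabel]; exact hμnt.map_configRelabel _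
    have hμnGG : IsGibbsMeasure (isingSpecification (zdGraph 2) β 0) μn := hμnG
    haveI : IsProbabilityMeasure μn := hμnGG.isProbabilityMeasure
    have hsm : Measurable (configShift (S := ℤˣ) (Pi.single (0 : Fin 2) (s : ℤ)) : SpinConfig (Site 2) → SpinConfig (Site 2)) :=
      (configShift _).measurable
    -- full-plane percolation of both signs for `μ₁`
    have hE : ∀ t : ℤˣ, μ (existsInfCluster (zdGraph 2) t) = 1 → μ₁ (existsInfCluster (zdGraph 2) (-t)) = 1 := by
      intro t ht
      rw [hμ₁, Measure.map_apply hsm (measurableSet_existsInfCluster (G := zdGraph 2) (-t)), hμn,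
        Measure.map_apply measurable_neg (hsm (measurableSet_existsInfCluster (G := zdGraph 2) (-t)))]
      have : (fun σ : SpinConfig (Site 2) => -σ) ⁻¹' (configShift (Pi.single 0 (s : ℤ)) ⁻¹' existsInfCluster (zdGraph 2) (-t)) =
          existsInfCluster (zdGraph 2) t := by
        ext ω
        simp only [Set.mem_preimage, configShift_mem_existsInfCluster_iff]
        rw [existsInfCluster_eq_existsInfClusterIn_univ, existsInfCluster_eq_existsInfClusterIn_univ,
          mem_existsInfClusterIn_iff, mem_existsInfClusterIn_iff, spinSites_neg_config, neg_neg]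
      rw [this]; exact ht
    have hp₁ : μ₁ (existsInfCluster (zdGraph 2) 1) = 1 := by have := hE (-1) hm; simpa using this
    have hm₁ : μ₁ (existsInfCluster (zdGraph 2) (-1)) = 1 := hE 1 hp
    -- Case 1 for `μ₁`
    have h0₁ : μ₁ {ω | ∃ x, (siteCluster (zdGraph 2) (spinSites 1 ω ∩ halfPlane 0) x).Infinite} = 0 := by
      have hmeas : MeasurableSet {ω : SpinConfig (Site 2) | ∃ x, (siteCluster (zdGraph 2) (spinSites 1 ω ∩ halfPlane 0) x).Infinite} :=
        MeasurableSet.of_tailEvents (measurableSet_tailEvents_existsInfClusterIn (G := zdGraph 2) 1 (halfPlane 0))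
      rw [hμ₁, Measure.map_apply hsm hmeas, hμn, Measure.map_apply measurable_neg (hsm hmeas)]
      have : (fun σ : SpinConfig (Site 2) => -σ) ⁻¹' (configShift (Pi.single 0 (s : ℤ)) ⁻¹'
          {ω : SpinConfig (Site 2) | ∃ x, (siteCluster (zdGraph 2) (spinSites 1 ω ∩ halfPlane 0) x).Infinite}) =
          {ω | ∃ y, (siteCluster (zdGraph 2) (spinSites (-1) ω ∩ halfPlane 0) y).Infinite} := by
        ext ω
        exact exists_infinite_plusCluster_configShift_neg_iff (s : ℤ) ω
      rw [this]; exact h0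
    obtain ⟨c, hc, hb⟩ := hSea hβc μ₁ hμ₁G hμ₁t hp₁ hm₁ h0₁ (-s)
    refine ⟨c, hc, fun m hmm => ?_⟩
    obtain ⟨a₀, b₀, hN₀⟩ := hb m hmm
    refine ⟨a₀, b₀, fun a b ha hb' => ?_⟩
    obtain ⟨H₀, hH₀⟩ := hN₀ a b ha hb'
    refine ⟨H₀, fun H hH => ?_⟩
    have h := hH₀ H hH
    rw [measureReal_goodAboveW_eq_flipSwap μ (Pi.single 0 (s : ℤ)) m H]
    have hneg : -(Pi.single 0 (s : ℤ) : Site 2) = Pi.single 0 (((-s : ℤˣ) : ℤ)) := by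
      rw [Units.val_neg, Pi.single_neg]
    rw [hneg]
    exact h

/-- **The Aizenman–Higuchi theorem** (Georgii–Higuchi 2000, Theorem, via Prop. 5.1 and Lemma 5.5;
Aizenman 1980; Higuchi 1981): for `β > β_c(2)` every Gibbs measure of the two-dimensional Ising
model at zero field is a mixture of the plus and the minus state. All cases of the proof of
Lemma 5.5 are now settled: Case 3 (`le_measureReal_goodAboveW_caseA`), Case 1 in the form
"`μ(E⁺_up) = 1`, `μ(E⁻_up) = 0`" (`goodAbove_bound_singleSign`), the mirror case
"`μ(E⁺_up) = 0`" (which forces `μ(E⁻_up) = 1` by the orthogonal-butterflies lemma, then the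
flip–swap symmetry of the duplicated system), and the degenerate case of a sign not percolating in
the plane. [cite: GeorgiiHiguchi2000, Theorem (p. 16), Prop. 5.1, Lemma 5.5] -/
theorem aizenman_higuchi_holds : aizenman_higuchi (β := β) := by
  classical
  refine aizenman_higuchi_of_seaCases fun hβc μ hμ hμt hp hm hcase s => ?_
  have hμG : IsGibbsMeasure (isingSpecification (zdGraph 2) β 0) μ := hμ
  haveI := hμG.isProbabilityMeasure
  have hmeas : ∀ t : ℤˣ, MeasurableSet (existsInfClusterIn (zdGraph 2) t (halfPlane (0 : ℤ)) : Set (SpinConfig (Site 2))) :=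
    fun t => MeasurableSet.of_tailEvents (measurableSet_tailEvents_existsInfClusterIn (G := zdGraph 2) t (halfPlane 0))
  -- zero–one laws for the two half-plane events
  have h01 : ∀ t : ℤˣ, μ (existsInfClusterIn (zdGraph 2) t (halfPlane (0 : ℤ))) = 0 ∨
      μ (existsInfClusterIn (zdGraph 2) t (halfPlane (0 : ℤ))) = 1 := fun t => hμt.measure_existsInfClusterIn (G := zdGraph 2) t _
  have hae_of_one : ∀ t : ℤˣ, μ (existsInfClusterIn (zdGraph 2) t (halfPlane (0 : ℤ))) = 1 →
      ∀ᵐ ω ∂μ, ∃ x, (siteCluster (zdGraph 2) (spinSites t ω ∩ halfPlane 0) x).Infinite := by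
    intro t ht
    have : ∀ᵐ ω ∂μ, ω ∈ existsInfClusterIn (zdGraph 2) t (halfPlane (0 : ℤ)) := by
      rw [← prob_compl_eq_zero_iff (hmeas t)] at ht; exact ae_iff.2 ht
    exact this
  -- the orthogonal-butterflies lemma: some sign percolates in the upper half-plane
  have hsome : μ (existsInfClusterIn (zdGraph 2) 1 (halfPlane (0 : ℤ))) = 1 ∨
      μ (existsInfClusterIn (zdGraph 2) (-1) (halfPlane (0 : ℤ))) = 1 := by
    obtain ⟨k, hk, t, ht⟩ := exists_horizontal_butterfly_of_coexistence hβc hμ hμt fun u => by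
      rcases Int.units_eq_one_or u with rfl | rfl
      · exact hp
      · exact hm
    have hsub : existsInfClusterIn (zdGraph 2) t {x : Site 2 | k ≤ x 1} ∩ existsInfClusterIn (zdGraph 2) t {x : Site 2 | x 1 ≤ k} ⊆
        existsInfClusterIn (zdGraph 2) t (halfPlane (0 : ℤ)) := by
      rintro ω ⟨⟨x, hx⟩, -⟩
      refine ⟨x, hx.mono (siteCluster_mono (Set.inter_subset_inter_right _ fun z hz => ?_) x)⟩
      have hz' : k ≤ z 1 := hz
      show (0 : ℤ) ≤ z 1
      rcases hk with rfl | rfl <;> omega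
    have hpos : μ (existsInfClusterIn (zdGraph 2) t (halfPlane (0 : ℤ))) ≠ 0 := fun h0 => ht (measure_mono_null hsub h0)
    rcases Int.units_eq_one_or t with rfl | rfl
    · left; exact (h01 1).resolve_left hpos
    · right; exact (h01 (-1)).resolve_left hpos
  rcases hcase with hP0 | hM0
  · -- `μ(E⁺_up) = 0`: then `μ(E⁻_up) = 1`; flip–swap to the single-sign case for `μ₁`
    have hM1 : μ (existsInfClusterIn (zdGraph 2) (-1) (halfPlane (0 : ℤ))) = 1 := by
      rcases hsome with h | h
      · exact absurd h (by rw [show (existsInfClusterIn (zdGraph 2) 1 (halfPlane (0 : ℤ)) : Set (SpinConfig (Site 2))) =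
          {ω | ∃ x, (siteCluster (zdGraph 2) (spinSites 1 ω ∩ halfPlane 0) x).Infinite} from rfl, hP0]; exact zero_ne_one)
      · exact h
    set μn : Measure (SpinConfig (Site 2)) := μ.map fun σ : SpinConfig (Site 2) => -σ with hμn
    set μ₁ : Measure (SpinConfig (Site 2)) := μn.map (configShift (Pi.single 0 (s : ℤ))) with hμ₁
    have hμnG : μn ∈ isingGibbsMeasures 2 β 0 := isGibbsMeasure_map_neg (zdGraph 2) β hμG
    have hμnt : IsTailTrivial μn := hμt.map_neg
    have hμ₁G : μ₁ ∈ isingGibbsMeasures 2 β 0 := mem_isingGibbsMeasures_map_configShift hμnG _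
    have hμ₁t : IsTailTrivial μ₁ := by rw [hμ₁, configShift_eq_configRelabel]; exact hμnt.map_configRelabel _
    have hμ₁GG : IsGibbsMeasure (isingSpecification (zdGraph 2) β 0) μ₁ := hμ₁G
    haveI : IsProbabilityMeasure μ₁ := hμ₁GG.isProbabilityMeasure
    have hP1' : μ₁ (existsInfClusterIn (zdGraph 2) 1 (halfPlane (0 : ℤ))) = 1 := by
      rw [hμ₁, hμn, measure_flipShift_existsInfClusterIn_halfPlane]; exact hM1
    have hM0' : μ₁ (existsInfClusterIn (zdGraph 2) (-1) (halfPlane (0 : ℤ))) = 0 := by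
      rw [hμ₁, hμn, measure_flipShift_existsInfClusterIn_halfPlane, neg_neg]; exact hP0
    have hP1ae : ∀ᵐ ω ∂μ₁, ∃ x, (siteCluster (zdGraph 2) (spinSites 1 ω ∩ halfPlane 0) x).Infinite := by
      have hmeas1 : MeasurableSet (existsInfClusterIn (zdGraph 2) 1 (halfPlane (0 : ℤ)) : Set (SpinConfig (Site 2))) := hmeas 1
      have : ∀ᵐ ω ∂μ₁, ω ∈ existsInfClusterIn (zdGraph 2) 1 (halfPlane (0 : ℤ)) := by
        rw [← prob_compl_eq_zero_iff hmeas1] at hP1'; exact ae_iff.2 hP1'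
      exact this
    obtain ⟨c, hc, hb⟩ := goodAbove_bound_singleSign hβc hμ₁G hμ₁t hP1ae hM0' (-s)
    refine ⟨c, hc, fun m hmm => ?_⟩
    obtain ⟨a₀, b₀, hN₀⟩ := hb m hmm
    refine ⟨a₀, b₀, fun a b ha hb' => ?_⟩
    obtain ⟨H₀, hH₀⟩ := hN₀ a b ha hb'
    refine ⟨H₀, fun H hH => ?_⟩
    have h := hH₀ H hH
    rw [measureReal_goodAboveW_eq_flipSwap μ (Pi.single 0 (s : ℤ)) m H]
    have hneg : -(Pi.single 0 (s : ℤ) : Site 2) = Pi.single 0 (((-s : ℤˣ) : ℤ)) := by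
      rw [Units.val_neg, Pi.single_neg]
    rw [hneg]
    exact h
  · -- `μ(E⁻_up) = 0`: then `μ(E⁺_up) = 1`, the single-sign case for `μ` itself
    have hP1 : μ (existsInfClusterIn (zdGraph 2) 1 (halfPlane (0 : ℤ))) = 1 := by
      rcases hsome with h | h
      · exact h
      · exact absurd h (by rw [show (existsInfClusterIn (zdGraph 2) (-1) (halfPlane (0 : ℤ)) : Set (SpinConfig (Site 2))) =
          {ω | ∃ y, (siteCluster (zdGraph 2) (spinSites (-1) ω ∩ halfPlane 0) y).Infinite} from rfl, hM0]; exact zero_ne_one)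
    exact goodAbove_bound_singleSign hβc hμ hμt (hae_of_one 1 hP1) hM0 s

end Main

end

end Literature.Probability.LatticeModels
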